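import Summits.BirchSwinnertonDyer.BirchSwinnertonDyer.Theorems.KimAtThreeFineKatoKPortEquivariance
import Summits.BirchSwinnertonDyer.Rank1Residual.Additive.PadicLogFormalGroup
import HarnessLib

/-!
# K-PORT glue (G4, points of `E(ℚ_p)` inside `E(K)`): the x1b logarithm `Λ = BallEval.ptLog` over
# `K ⊇ ℚ_p` RESTRICTS on `ℚ_p`-points to the tree's `ℚ_p`-logarithm `log_W ∘ z = padicLogPoint`
# (hence to n1011's `padicLog` on `E⁽²⁾(ℚ_p)`), and `E₁(ℚ_p) = E₁(K) ∩ E(ℚ_p)`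
# (cell `bsd-addord`, seat w2-kport gen 0; `--supports stmt-BirchSwinnertonDyer-19560`, helper)

HONEST FRAMING. Route W2 (`route-BirchSwinnertonDyer-KimAtThreeKolyvagin`), crux 19560
`KatoKuriharaPortThreeShared`, residual ⟨C1⟩ clause (C1.c): kim3's SAT₀ runs a trace/norm argument
between `E(K_w)` and `E(ℚ₃)` and needs "`log|_{E(ℚ₃)} = ` n1011's `padicLog` under `K ← ℚ_[3]`"
(brief KIM3-KPORT-BRIEF-g12 §3 (P2), inventory HOME/kport/KPORT-INVENTORY-g0.md (G4)). The K-side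
logarithm of record is the x1b series' `Λ = BallEval.ptLog p K M` on `E₁(K)` of `E = curveK p K M = M ⊗ K`
(`M/ℤ_p` with elliptic generic fibre `X = M ⊗ ℚ_p = M.map PadicInt.Coe.ringHom`); the ℚ_p-side objects are
the tree's `X.formalParameter`, `X.IsInReductionKernel`, `X.formalFiltration`, `X.padicLogPoint = log_X ∘ z`
(`Literature/…/FormalGroup`, `PadicPointsFiltration`) and n1011's `LocalLog.padicLog X`
(`Additive/PadicLogImage`, `= padicLogPoint` on `E⁽²⁾(ℚ_p)` by `Additive/PadicLogFormalGroup`). The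
`ℚ_p`-points embed by Mathlib's `ι = WeierstrassCurve.Affine.Point.map (Algebra.ofId ℚ_[p] K)` (the curve
`curveK p K M` is DEFINITIONALLY `X.baseChange K`, and `curveK p ℚ_[p] M` is definitionally `X`).
TOOL theorems only (no definition, no named fact, no `sorry`); closes nothing by itself; nothing booked.

## What is proved (`X = M.map PadicInt.Coe.ringHom`, `ι = Affine.Point.map (Algebra.ofId ℚ_[p] K)`)

* §1 `K = ℚ_p`: `curveK_padic` (`curveK p ℚ_[p] M = X`, `rfl`), `isIntegral_valuationInteger_padic`,
  `formalParameter_eq_zCoord`,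
  `isInReductionKernel_iff_mem_kernel` (`X.IsInReductionKernel P ↔ P ∈ FormalGroupChart.kernel`),
  `mem_formalFiltration_zero_iff_mem_kernel`, **`ptLog_padic_eq_padicLogPoint`**
  (`BallEval.ptLog p ℚ_[p] M = X.padicLogPoint`, everywhere), `ptLog_padic_eq_padicLog_of_mem`
  (`= padicLog X` on `E⁽²⁾(ℚ_p)`).
* §2 base change: `norm_ofId_eq` (`ℚ_p → K` is an isometry), **`map_ofId_mem_kernel_iff`**
  (`ι P ∈ E₁(K) ↔ P ∈ E₁(ℚ_p)`), `zCoord_map_ofId`, **`ptLog_map_ofId`**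
  (`Λ_K(ι P) = algebraMap (log_X(z P))` on `E₁(ℚ_p)`), `ptLog_map_ofId_of_mem_two`
  (`Λ_K(ι P) = algebraMap (padicLog X P)` on `E⁽²⁾(ℚ_p)`).

The saturated form `Λ̃_K(ι P) = algebraMap (padicLog X P)` for ALL `P ∈ E(ℚ_p)` follows with the sibling
`…KPortSatLog` (`Λ̃(Q) = Λ(N•Q)/N`, `N = [E(ℚ_p) : E⁽²⁾(ℚ_p)]`) and is recorded in the assembly file.

References: J. H. Silverman, *The Arithmetic of Elliptic Curves*, 2nd ed. (2009), IV.6.4, Prop. VII.2.2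
[SilvermanAEC2009]; kim3 brief HOME/kim3/KIM3-KPORT-BRIEF-g12.md §3 (P2).
-/

noncomputable section

-- the cell's Theorems namespace `Summit.BirchSwinnertonDyer.BirchSwinnertonDyer.…` repeats the summit name by design (D-0017)
set_option linter.dupNamespace false

open scoped Classical
open PowerSeries

namespace Summit.BirchSwinnertonDyer.BirchSwinnertonDyer.Theorems.KPort

open Summit.BirchSwinnertonDyer.Rank1Residual.Additive.BallEval
open Summit.BirchSwinnertonDyer.Rank1Residual.Additive.LocalLog
open Literature.NumberTheory.GaloisRepresentations.LubinTate (unitBall mem_unitBall_iff)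
open Literature.NumberTheory.EllipticCurves Literature.NumberTheory.EllipticCurves.FormalGroupChart
open WeierstrassCurve

variable {p : ℕ} [hp : Fact p.Prime] {M : WeierstrassCurve ℤ_[p]}

/-! ## §1 `K = ℚ_p`: the x1b objects are the tree's `ℚ_p` objects -/

section Padic

variable (p M) in
/-- `curveK p ℚ_p M = X = M ⊗ ℚ_p` definitionally. [folklore] -/
theorem curveK_padic : curveK p ℚ_[p] M = M.map PadicInt.Coe.ringHom := rfl

variable (p M) in
/-- `X = M ⊗ ℚ_p` is integral for the unit ball `𝒪_{ℚ_p} = {‖x‖ ≤ 1}` of the norm valuation (the x1b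
series' `isIntegral_curveK` at `K = ℚ_p`; introduce with `haveI`). [folklore] -/
theorem isIntegral_valuationInteger_padic :
    (M.map PadicInt.Coe.ringHom).IsIntegral (NormedField.valuation (K := ℚ_[p])).integer :=
  isIntegral_curveK p ℚ_[p] M

/-- The tree's `formalParameter` (`ℚ_p`) is the generic parameter `zCoord`. [folklore] -/
theorem formalParameter_eq_zCoord (P : (M.map PadicInt.Coe.ringHom).toAffine.Point) :
    (M.map PadicInt.Coe.ringHom).formalParameter P = P.zCoord := by
  rcases P with _ | ⟨x, y, h⟩ <;> rfl

/-- The tree's `IsInReductionKernel` (`ℚ_p`, `‖x‖ > 1`) is membership in `FormalGroupChart.kernel` for the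
norm valuation of `ℚ_p`. [cite: SilvermanAEC2009, Prop. VII.2.2] -/
theorem isInReductionKernel_iff_mem_kernel
    [(M.map PadicInt.Coe.ringHom).IsIntegral (NormedField.valuation (K := ℚ_[p])).integer]
    (P : (M.map PadicInt.Coe.ringHom).toAffine.Point) :
    (M.map PadicInt.Coe.ringHom).IsInReductionKernel P ↔
      P ∈ kernel (NormedField.valuation (K := ℚ_[p])) (M.map PadicInt.Coe.ringHom) := by
  rcases P with _ | ⟨x, y, h⟩
  · exact ⟨fun _ => (kernel (NormedField.valuation (K := ℚ_[p])) (M.map PadicInt.Coe.ringHom)).zero_mem,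
      fun _ => (M.map PadicInt.Coe.ringHom).isInReductionKernel_zero⟩
  · rw [isInReductionKernel_some, some_mem_kernel_iff, ← NNReal.coe_lt_coe, NormedField.valuation_apply,
      coe_nnnorm, NNReal.coe_one]

/-- `E₁(ℚ_p) = X.formalFiltration 0` is `FormalGroupChart.kernel`. [cite: SilvermanAEC2009, Prop. VII.2.2] -/
theorem mem_formalFiltration_zero_iff_mem_kernel [(M.map PadicInt.Coe.ringHom).IsIntegral ℤ_[p]]
    [(M.map PadicInt.Coe.ringHom).IsElliptic]
    [(M.map PadicInt.Coe.ringHom).IsIntegral (NormedField.valuation (K := ℚ_[p])).integer]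
    (P : (M.map PadicInt.Coe.ringHom).toAffine.Point) :
    P ∈ (M.map PadicInt.Coe.ringHom).formalFiltration 0 ↔
      P ∈ kernel (NormedField.valuation (K := ℚ_[p])) (M.map PadicInt.Coe.ringHom) := by
  rw [mem_formalFiltration_zero_iff, isInReductionKernel_iff_mem_kernel]

/-- **On `ℚ_p`-points the x1b logarithm IS the tree's `log_X ∘ z`**: `BallEval.ptLog p ℚ_p M P =
X.padicLogPoint P` for every point (both are the `tsum` `∑ logₙ z(P)ⁿ`). [cite: SilvermanAEC2009, IV.6.4] -/
theorem ptLog_padic_eq_padicLogPoint (P : (M.map PadicInt.Coe.ringHom).toAffine.Point) :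
    ptLog p ℚ_[p] M P = (M.map PadicInt.Coe.ringHom).padicLogPoint P := by
  rw [ptLog, bLog, qEval, padicLogPoint, padicFormalLog, formalParameter_eq_zCoord]
  refine tsum_congr fun n => ?_
  rw [Algebra.algebraMap_self, RingHom.id_apply]
  rfl

/-- Hence on `E⁽²⁾(ℚ_p)` it is n1011's `padicLog`. [cite: SilvermanAEC2009, IV.6.4 and VII.6.3] -/
theorem ptLog_padic_eq_padicLog_of_mem [(M.map PadicInt.Coe.ringHom).IsIntegral ℤ_[p]]
    [(M.map PadicInt.Coe.ringHom).IsElliptic] {P : (M.map PadicInt.Coe.ringHom).toAffine.Point}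
    (hP : P ∈ (M.map PadicInt.Coe.ringHom).formalFiltration 2) :
    ptLog p ℚ_[p] M P = padicLog (M.map PadicInt.Coe.ringHom) P := by
  rw [ptLog_padic_eq_padicLogPoint, padicLog_eq_padicLogPoint_of_mem _ hP]

end Padic

/-! ## §2 The embedding `E(ℚ_p) ↪ E(K)` -/

section BaseChange

variable {K : Type*} [NontriviallyNormedField K] [NormedAlgebra ℚ_[p] K] [IsUltrametricDist K]

omit [IsUltrametricDist K] in
/-- `ℚ_p → K` is an isometry (the hypothesis `hφ` of `…KPortEquivariance` for `Algebra.ofId`). [folklore] -/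
theorem norm_ofId_eq (x : ℚ_[p]) : ‖Algebra.ofId ℚ_[p] K x‖ = ‖x‖ :=
  norm_algebraMap' K x

/-- **`ι P ∈ E₁(K) ↔ P ∈ E₁(ℚ_p)`** (`E₁(ℚ_p) = E₁(K) ∩ E(ℚ_p)`). [cite: SilvermanAEC2009, Prop. VII.2.2] -/
theorem map_ofId_mem_kernel_iff
    [(M.map PadicInt.Coe.ringHom).IsIntegral (NormedField.valuation (K := ℚ_[p])).integer]
    [(curveK p K M).IsIntegral (NormedField.valuation (K := K)).integer]
    (P : (M.map PadicInt.Coe.ringHom).toAffine.Point) :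
    Affine.Point.map (W' := (M.map PadicInt.Coe.ringHom).toAffine) (Algebra.ofId ℚ_[p] K) P ∈
        kernel (NormedField.valuation (K := K)) (curveK p K M) ↔
      (M.map PadicInt.Coe.ringHom).IsInReductionKernel P := by
  haveI : (curveK p ℚ_[p] M).IsIntegral (NormedField.valuation (K := ℚ_[p])).integer :=
    ‹(M.map PadicInt.Coe.ringHom).IsIntegral (NormedField.valuation (K := ℚ_[p])).integer›
  rw [isInReductionKernel_iff_mem_kernel]
  exact map_mem_kernel_iff (K := ℚ_[p]) (Algebra.ofId ℚ_[p] K) norm_ofId_eq P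

/-- `z(ι P) = z(P)` (in `K`). [folklore] -/
theorem zCoord_map_ofId (P : (M.map PadicInt.Coe.ringHom).toAffine.Point) :
    Affine.Point.zCoord (W := (curveK p K M).toAffine)
        (Affine.Point.map (W' := (M.map PadicInt.Coe.ringHom).toAffine) (Algebra.ofId ℚ_[p] K) P) =
      algebraMap ℚ_[p] K ((M.map PadicInt.Coe.ringHom).formalParameter P) := by
  rw [formalParameter_eq_zCoord]
  exact zCoord_map (K := ℚ_[p]) (Algebra.ofId ℚ_[p] K) P

variable [CompleteSpace K]

/-- **`Λ_K(ι P) = log_X(z(P))` for `P ∈ E₁(ℚ_p)`**: the K-logarithm restricts to the `ℚ_p`-logarithm.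
[cite: SilvermanAEC2009, IV.6.4 and Prop. VII.2.2] -/
theorem ptLog_map_ofId
    [(M.map PadicInt.Coe.ringHom).IsIntegral (NormedField.valuation (K := ℚ_[p])).integer]
    {P : (M.map PadicInt.Coe.ringHom).toAffine.Point}
    (hP : (M.map PadicInt.Coe.ringHom).IsInReductionKernel P) :
    ptLog p K M (Affine.Point.map (W' := (M.map PadicInt.Coe.ringHom).toAffine) (Algebra.ofId ℚ_[p] K) P) =
      algebraMap ℚ_[p] K ((M.map PadicInt.Coe.ringHom).padicLogPoint P) := by
  haveI : (curveK p ℚ_[p] M).IsIntegral (NormedField.valuation (K := ℚ_[p])).integer :=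
    ‹(M.map PadicInt.Coe.ringHom).IsIntegral (NormedField.valuation (K := ℚ_[p])).integer›
  rw [← ptLog_padic_eq_padicLogPoint]
  exact ptLog_map (K := ℚ_[p]) (Algebra.ofId ℚ_[p] K) norm_ofId_eq
    ((isInReductionKernel_iff_mem_kernel P).mp hP)

/-- **`Λ_K(ι P) = padicLog X P` for `P ∈ E⁽²⁾(ℚ_p)`** (n1011's logarithm). [cite: SilvermanAEC2009, IV.6.4 and VII.6.3] -/
theorem ptLog_map_ofId_of_mem_two [(M.map PadicInt.Coe.ringHom).IsIntegral ℤ_[p]]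
    [(M.map PadicInt.Coe.ringHom).IsElliptic]
    [(M.map PadicInt.Coe.ringHom).IsIntegral (NormedField.valuation (K := ℚ_[p])).integer]
    {P : (M.map PadicInt.Coe.ringHom).toAffine.Point}
    (hP : P ∈ (M.map PadicInt.Coe.ringHom).formalFiltration 2) :
    ptLog p K M (Affine.Point.map (W' := (M.map PadicInt.Coe.ringHom).toAffine) (Algebra.ofId ℚ_[p] K) P) =
      algebraMap ℚ_[p] K (padicLog (M.map PadicInt.Coe.ringHom) P) := by
  have h0 : P ∈ (M.map PadicInt.Coe.ringHom).formalFiltration 0 :=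
    (M.map PadicInt.Coe.ringHom).formalFiltration_antitone (Nat.zero_le 2) hP
  rw [ptLog_map_ofId ((mem_formalFiltration_zero_iff _).mp h0), ← padicLog_eq_padicLogPoint_of_mem _ hP]

end BaseChange

end Summit.BirchSwinnertonDyer.BirchSwinnertonDyer.Theorems.KPort

end
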